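import Literature.Probability.Percolation.IsoradialBoxCrossingAssembly
import Literature.Probability.Percolation.IsoradialDualTracks
import Literature.Probability.Percolation.IsoradialDualFinite
import Literature.Probability.Percolation.IsoradialUsedFaces
import Literature.Probability.Percolation.Isoradial
import HarnessLib

/-!
# What remains of `gm_boxCrossingBounds_uniform`: aspect-ratio-2 lower bounds on `𝒢`, no clash, dual connectivity

The named fact `gm_boxCrossingBounds_uniform` (`Literature.Probability.Percolation.Isoradial`) is
Grimmett–Manolescu's Theorem 3.1 in its uniform form (3.1) (PTRF 159 (2014) = arXiv:1204.0505,
§3), rendered with the two-sided, all-aspect-ratio bounds `BoxCrossingBounds`. This file proves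
the **reduction of the fact to three inputs**, each about the printed class
`𝒢(ε, I)` = preconnected, countable, locally finite graphs on types in `Type`, isoradially and
rhombically embedded with BAP(ε) and the printed SGP(I):

1. `H𝒢` — **Theorem 3.1 proper, in the paper's own formulation**: for `(ε, I)` there are
   `δ > 0`, `n₀` such that every `G ∈ 𝒢(ε, I)` crosses, under `P_G`, the `2n × n` boxes
   horizontally and the `n × 2n` boxes vertically with probability `≥ δ` for `n ≥ n₀`,
   uniformly in translations (§2.3 Def. 2.2 with the Harris–FKG remark; §§5–7);
2. `Hclash` — no vertex position coincides with a face-centre position (GM §4.1: the diamond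
   graph is a bipartite quadrangulation; see `IsoradialDualityExclusion`);
3. `Hconn` — the dual graph on the used faces is preconnected (GM §4.1: `G*` is the planar dual).

Inputs 2 and 3 are properties of every rhombic tiling in the sense of the paper (a *planar graph*
with rhombic faces, §4.1) and hold for the tree's `IsIsoradial ∧ IsRhombicTiling` exactly when
`G` is preconnected; they are isolated here as hypotheses because their proofs from the tree's
rendering are global (parity of the quadrangulation) and not yet formalized.

Proof: for `G ∈ 𝒢(ε, I)` restrict to the used faces (`restrictFaces`, same measure and drawing,
countable face type), note that the dual embedding is again in `𝒢(ε, I)` — isoradial, a rhombic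
tiling, BAP(ε) (`IsoradialDualProofs`), SGP(I) (`IsoradialDualTracks`), countable and locally
finite (`IsoradialUsedFaces`, `IsoradialDualFinite`), preconnected (`Hconn`) — so that `H𝒢`
applies to it with the *same* `(δ, n₀)`, and conclude by `boxCrossingBounds_of_aspect_two`
(`IsoradialBoxCrossingAssembly`) with the explicit constants `boxConst (min δ 1) ρ`,
`boxScale n₀ ρ`, which depend on `(ε, I, ρ)` only through `(δ, n₀, ρ)`.

## References

* G. R. Grimmett, I. Manolescu, *Bond percolation on isoradial graphs: criticality and
  universality*, PTRF 159 (2014), arXiv:1204.0505, §2.3, §3 (Thm 3.1, (3.1)), §4.1–4.2.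
-/

noncomputable section

namespace Literature.Probability.Percolation

open MeasureTheory Complex Set
open Literature.Probability.LatticeModels Literature.Probability.LatticeModels.RhombicEmbedding

/-- A rhombic tiling has an edge (its rhombi cover the plane). [folklore] -/
theorem nonempty_edgeSet_of_isRhombicTiling {V F : Type*} {G : SimpleGraph V}
    {emb : RhombicEmbedding G F} (hrh : emb.IsRhombicTiling) : Nonempty G.edgeSet := by
  have h : (0 : ℂ) ∈ ⋃ e : G.edgeSet, emb.rhombus e := by rw [hrh.iUnion_rhombus]; trivial
  obtain ⟨e, -⟩ := Set.mem_iUnion.1 h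
  exact ⟨e⟩

/-- In a preconnected graph with an edge every vertex has a neighbour. [folklore] -/
theorem exists_adj_of_preconnected_of_nonempty_edgeSet {V : Type*} {G : SimpleGraph V} (hconn : G.Preconnected)
    (he : Nonempty G.edgeSet) (v : V) : ∃ u, G.Adj v u := by
  obtain ⟨⟨e, he⟩⟩ := he
  induction e using Sym2.ind with
  | h x y =>
    rw [SimpleGraph.mem_edgeSet] at he
    by_cases hv : v = x
    · exact ⟨y, hv ▸ he⟩
    · obtain ⟨p⟩ := hconn v x
      cases p with
      | nil => exact absurd rfl hv
      | cons h _ => exact ⟨_, h⟩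

/-- **Reduction of `gm_boxCrossingBounds_uniform`** to: (1) Theorem 3.1 of Grimmett–Manolescu in
the paper's formulation — aspect-ratio-2 horizontal and vertical crossing probabilities `≥ δ`
from scale `n₀` on, uniformly on `𝒢(ε, I)`; (2) the no-clash property; (3) preconnectedness of
the dual graph on the used faces — (2) and (3) for every graph of `𝒢(ε, I)`. See the module
docstring. [cite: GrimmettManolescu2014Isoradial, §3 Thm 3.1 with (3.1); §2.3 (Harris–FKG remark); §2.2 and §4.1 (the dual)] -/
theorem gm_boxCrossingBounds_uniform_of_aspect_two_lower_bounds
    (H𝒢 : ∀ (ε : ℝ), 0 < ε → ∀ I : ℕ, ∃ δ > (0 : ℝ), ∃ n₀ : ℕ,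
      ∀ (V F : Type) [Countable V] [DecidableEq V] [DecidableEq F] (G : SimpleGraph V)
        [G.LocallyFinite] (emb : RhombicEmbedding G F), G.Preconnected → emb.IsIsoradial →
        emb.IsRhombicTiling → emb.HasBoundedAngles ε → emb.SquareGridPropertyGM I →
        ∀ n : ℕ, n₀ ≤ n → ∀ w : ℂ,
          δ ≤ emb.isoradialPercolation.real (embRectCrossing (fun v => emb.z v - w) (2 * n) n) ∧
          δ ≤ emb.isoradialPercolation.real (embTBCrossing (fun v => emb.z v - w) n (2 * n)))
    (Hclash : ∀ (V F : Type) [DecidableEq V] [DecidableEq F] (G : SimpleGraph V)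
        (emb : RhombicEmbedding G F) (ε : ℝ) (I : ℕ), G.Preconnected → emb.IsIsoradial →
        emb.IsRhombicTiling → 0 < ε → emb.HasBoundedAngles ε → emb.SquareGridPropertyGM I →
        ∀ d D : G.Dart, emb.z d.fst ≠ emb.c (emb.leftFace D))
    (Hconn : ∀ (V F : Type) [DecidableEq V] [DecidableEq F] (G : SimpleGraph V)
        (emb : RhombicEmbedding G F) (ε : ℝ) (I : ℕ), G.Preconnected → emb.IsIsoradial →
        emb.IsRhombicTiling → 0 < ε → emb.HasBoundedAngles ε → emb.SquareGridPropertyGM I →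
        emb.restrictFaces.dualGraph.Preconnected) :
    gm_boxCrossingBounds_uniform := by
  intro ε hε I ρ hρ
  obtain ⟨δ, hδ, n₀, hlow⟩ := H𝒢 ε hε I
  -- constants, from `(δ, n₀, ρ)` only
  set δ' : ℝ := min δ 1 with hδ'
  have hδ'pos : 0 < δ' := lt_min hδ one_pos
  have hδ'1 : δ' ≤ 1 := min_le_right _ _
  have hδ'δ : δ' ≤ δ := min_le_left _ _
  refine ⟨boxConst δ' ρ, boxConst_pos hδ'pos ρ, boxScale n₀ ρ, ?_⟩
  intro V F _ _ _ G _ emb hconn hiso hrh hbap hsgp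
  classical
  -- restrict to the used faces: same measure, same drawing
  set emb' := emb.restrictFaces with hemb'
  have hiso' : emb'.IsIsoradial := hiso.restrictFaces
  have hrh' : emb'.IsRhombicTiling := hrh.restrictFaces
  have hbap' : emb'.HasBoundedAngles ε := hbap.restrictFaces
  have hsgp' : emb'.SquareGridPropertyGM I := hsgp.restrictFaces
  haveI : Countable emb.usedFaces := countable_usedFaces
  -- the dual of the restriction is in `𝒢(ε, I)`
  have he : Nonempty G.edgeSet := nonempty_edgeSet_of_isRhombicTiling hrh
  have hnb : ∀ v : V, ∃ u, G.Adj v u := exists_adj_of_preconnected_of_nonempty_edgeSet hconn he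
  letI : emb'.dualGraph.LocallyFinite := locallyFiniteDualGraph hiso' hrh' hbap' hε hnb
  have hisoD : emb'.dual.IsIsoradial := isIsoradial_dual hiso' hrh'
  have hrhD : emb'.dual.IsRhombicTiling := isRhombicTiling_dual hiso' hrh'
  have hbapD : emb'.dual.HasBoundedAngles ε := hasBoundedAngles_dual hiso' hrh' hbap'
  have hsgpD : emb'.dual.SquareGridPropertyGM I := hsgp'.dual hiso' hrh'
  have hconnD : emb'.dualGraph.Preconnected := Hconn V F G emb ε I hconn hiso hrh hε hbap hsgp
  -- aspect-ratio-2 inputs for the restriction and for its dual, with the same `(δ, n₀)`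
  have hprim := hlow V emb.usedFaces G emb' hconn hiso' hrh' hbap' hsgp'
  have hdual := hlow emb.usedFaces V emb'.dualGraph emb'.dual hconnD hisoD hrhD hbapD hsgpD
  have hclash' : ∀ d D : G.Dart, emb'.z d.fst ≠ emb'.c (emb'.leftFace D) :=
    Hclash V F G emb ε I hconn hiso hrh hε hbap hsgp
  -- assembly
  have h := boxCrossingBounds_of_aspect_two (emb := emb') hiso' hrh' hclash' hδ'pos hδ'1
    (n₀ := n₀)
    (fun n hn w => hδ'δ.trans ((hprim n hn w).1))
    (fun n hn w => hδ'δ.trans ((hprim n hn w).2))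
    (fun n hn w => hδ'δ.trans ((hdual n hn w).1))
    (fun n hn w => hδ'δ.trans ((hdual n hn w).2)) hρ
  simpa [hemb'] using h

end Literature.Probability.Percolation

end
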